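import Mathlib
import Summits.QuantumFields.YangMills.Theorems.LangevinControlUVOSLegsFromFemtoAndGapDefs
import Summits.QuantumFields.YangMills.Theorems.UniversalDetectorLatticeRiemannQ2Template

/-!
# Route `UniversalDetector`, support item `LimitExtraction` (stmt-QuantumFields-26597): `Q2` adapter

Ideator seat ym-idea-8 g4.  The analytic toolkit (`UniversalDetectorLatticeRiemannBounds`, `…Limit`,
`…Perturbation`, `…Q2Shape`, `…Q2Template`) restated in the vocabulary of the route
(`DlrCollarTransfer.Q2`, `torusE`, `dens`, `d = 4`, time coordinate `0`):
* `Q2_eq_normalised` — `Q2 β L s w₁ w₂ = (s⁴)² Σ Σ w₁(s x) w₂(s x') · (s⁻⁸ Cov(A_x, A_{x'}))`;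
* `tendsto_Q2_of_near_kernel` — the last conjunct of `LimitExtraction`
  (`Q2 (βs (φ k)) (Ls (φ k)) (a (βs (φ k))) w₁ w₂ → ∫ x, ∫ y, w₁ x * w₂ y * K (y - x)`) follows once the
  lattice prover shows that `a_k⁻⁸ Cov_k(A_x, A_{x'})` stays within `M` of `K(a_k x' - a_k x)` on the pairs
  charged by `w₁(a_k x) w₂(a_k x')` (torus translation covariance + (TIGHT) at physical time separation
  `≥ 2t₀`; no time wrap once `a_k L_k > 2T`) and within `ε` on the charged pairs of radius `≤ R` (local
  uniform convergence of `ker` to `K` on the annulus `2t₀ ≤ ‖·‖ ≤ 2R`, no spatial wrap there), eventually in `k`;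
* `integral_nonneg_of_Q2_nonneg` — the reflection-positivity conjunct's shape: eventual
  `0 ≤ Q2 … (ϑw) w` (lattice RP) gives `0 ≤ ∫ x, ∫ y, (ϑw) x * w y * K (y - x)`.
No summit, leg or spine statement is proved here.
-/

set_option autoImplicit false

namespace Summit.QuantumFields.YangMills.Cruxes.UniversalDetectorLimitExtraction

open scoped SchwartzMap
open Finset MeasureTheory Filter Topology Literature.Probability.LatticeModels
  Literature.MathematicalPhysics.QuantumLattice Literature.MathematicalPhysics.QuantumFieldTheory
  Summit.QuantumFields.YangMills.Cruxes.OSLegsFromFemtoAndGap.DlrCollarTransfer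

variable (G : Type) [Group G] [TopologicalSpace G] [IsTopologicalGroup G] [CompactSpace G]
  [MeasurableSpace G] [BorelSpace G] (r : LatticeRep G)

/-- `Q2` in normalised form: `Q2 β L s w₁ w₂ = s^{8} Σ Σ w₁(s x) w₂(s x') · (s^{-8} Cov(A_x, A_{x'}))` (`s ≠ 0`). -/
theorem Q2_eq_normalised (β : ℝ) (L : ℕ) {s : ℝ} (hs : s ≠ 0)
    (w₁ w₂ : 𝓢(EuclideanSpace ℝ (Fin 4), ℝ)) :
    Q2 G r β L s w₁ w₂ = (s ^ 4) ^ 2 * ∑ x ∈ box 4 L, ∑ x' ∈ box 4 L,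
      w₁ (s • siteToE x) * w₂ (s • siteToE x') * (s⁻¹ ^ 8 *
        (torusE G r β L (fun U => dens G r x U * dens G r x' U)
          - torusE G r β L (dens G r x) * torusE G r β L (dens G r x'))) := by
  have h8 : (s ^ 4) ^ 2 * s⁻¹ ^ 8 = 1 := by
    rw [inv_pow, ← pow_mul, show 4 * 2 = 8 by norm_num, mul_inv_cancel₀ (pow_ne_zero 8 hs)]
  unfold Q2
  rw [mul_sum]
  refine sum_congr rfl fun x _ => ?_
  rw [mul_sum]
  refine sum_congr rfl fun x' _ => ?_
  calc _ = ((s ^ 4) ^ 2 * s⁻¹ ^ 8) * (w₁ (s • siteToE x) * w₂ (s • siteToE x') *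
        (torusE G r β L (fun U => dens G r x U * dens G r x' U)
          - torusE G r β L (dens G r x) * torusE G r β L (dens G r x'))) := by rw [h8, one_mul]
    _ = _ := by ring

/-- **Adapter for the last conjunct of `LimitExtraction`.**  Along a sequence of couplings `β_k`, torus
half-sides `L_k` and spacings `0 < s_k → 0` with `s_k L_k → ∞` (for the route: `β_k = βs (φ k)`,
`L_k = Ls (φ k)`, `s_k = a (βs (φ k))`), let `w₁, w₂` be real Schwartz functions with `tsupport`s in the
opposite time slabs `{-y₀ ≥ t₀}`, `{y₀ ≥ t₀}` (`t₀ > 0`) and `K` continuous on `{z ≠ 0}`, bounded on every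
`{‖z‖ ≥ η}`.  If the rescaled truncated two-point function `s_k^{-8} Cov_k(A_x, A_{x'})` stays within `M` of
`K(s_k x' - s_k x)` on the pairs charged by `w₁(s_k x) w₂(s_k x')`, eventually, and within `ε` of it on the
charged pairs of radius `≤ R`, eventually (all `R, ε > 0`) — the inputs a lattice prover gets from torus
translation covariance, (TIGHT) at physical time separation `≥ 2t₀` and the local uniform convergence of
`ker` to `K` — then `Q2 β_k L_k s_k w₁ w₂ → ∫ x, ∫ y, w₁ x * w₂ y * K (y - x)`. -/
theorem tendsto_Q2_of_near_kernel (w₁ w₂ : 𝓢(EuclideanSpace ℝ (Fin 4), ℝ))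
    (K : EuclideanSpace ℝ (Fin 4) → ℝ) (t₀ : ℝ) (ht₀ : 0 < t₀)
    (h₁ : tsupport (w₁ : EuclideanSpace ℝ (Fin 4) → ℝ) ⊆ {y | t₀ ≤ -(y 0)})
    (h₂ : tsupport (w₂ : EuclideanSpace ℝ (Fin 4) → ℝ) ⊆ {y | t₀ ≤ y 0})
    (hKc : ContinuousOn K {z | z ≠ 0}) (hKb : ∀ η : ℝ, 0 < η → ∃ C : ℝ, ∀ z, η ≤ ‖z‖ → |K z| ≤ C)
    (β : ℕ → ℝ) (L : ℕ → ℕ) (s : ℕ → ℝ) (hs : ∀ k, 0 < s k) (hs0 : Tendsto s atTop (𝓝 0))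
    (hL : Tendsto (fun k => s k * L k) atTop atTop) (M : ℝ)
    (hM : ∀ᶠ k in atTop, ∀ x ∈ box 4 (L k), ∀ x' ∈ box 4 (L k),
      w₁ (s k • siteToE x) ≠ 0 → w₂ (s k • siteToE x') ≠ 0 →
      |(s k)⁻¹ ^ 8 * (torusE G r (β k) (L k) (fun U => dens G r x U * dens G r x' U)
          - torusE G r (β k) (L k) (dens G r x) * torusE G r (β k) (L k) (dens G r x'))
        - K (s k • siteToE x' - s k • siteToE x)| ≤ M)
    (hnear : ∀ R ε : ℝ, 0 < R → 0 < ε → ∀ᶠ k in atTop, ∀ x ∈ box 4 (L k), ∀ x' ∈ box 4 (L k),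
      ‖s k • siteToE x‖ ≤ R → ‖s k • siteToE x'‖ ≤ R →
      w₁ (s k • siteToE x) ≠ 0 → w₂ (s k • siteToE x') ≠ 0 →
      |(s k)⁻¹ ^ 8 * (torusE G r (β k) (L k) (fun U => dens G r x U * dens G r x' U)
          - torusE G r (β k) (L k) (dens G r x) * torusE G r (β k) (L k) (dens G r x'))
        - K (s k • siteToE x' - s k • siteToE x)| ≤ ε) :
    Tendsto (fun k => Q2 G r (β k) (L k) (s k) w₁ w₂) atTop
      (𝓝 (∫ x, ∫ y, w₁ x * w₂ y * K (y - x))) := by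
  have h := tendsto_latticeDoubleSum_of_near_kernel (0 : Fin 4) w₁ w₂ K t₀ ht₀ h₁ h₂ hKc hKb s hs hs0 L hL
    (fun k x x' => (s k)⁻¹ ^ 8 * (torusE G r (β k) (L k) (fun U => dens G r x U * dens G r x' U)
      - torusE G r (β k) (L k) (dens G r x) * torusE G r (β k) (L k) (dens G r x'))) M hM hnear
  refine h.congr fun k => ?_
  exact (Q2_eq_normalised G r (β k) (L k) (hs k).ne' w₁ w₂).symm

/-- **Adapter for the reflection-positivity conjunct.**  Under the hypotheses of `tendsto_Q2_of_near_kernel`,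
eventual lattice positivity `0 ≤ Q2 β_k L_k s_k w₁ w₂` (for the route: `w₁ = ϑ w₂` and reflection positivity
of the Wilson measure) gives `0 ≤ ∫ x, ∫ y, w₁ x * w₂ y * K (y - x)`. -/
theorem integral_nonneg_of_Q2_nonneg (w₁ w₂ : 𝓢(EuclideanSpace ℝ (Fin 4), ℝ))
    (K : EuclideanSpace ℝ (Fin 4) → ℝ) (t₀ : ℝ) (ht₀ : 0 < t₀)
    (h₁ : tsupport (w₁ : EuclideanSpace ℝ (Fin 4) → ℝ) ⊆ {y | t₀ ≤ -(y 0)})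
    (h₂ : tsupport (w₂ : EuclideanSpace ℝ (Fin 4) → ℝ) ⊆ {y | t₀ ≤ y 0})
    (hKc : ContinuousOn K {z | z ≠ 0}) (hKb : ∀ η : ℝ, 0 < η → ∃ C : ℝ, ∀ z, η ≤ ‖z‖ → |K z| ≤ C)
    (β : ℕ → ℝ) (L : ℕ → ℕ) (s : ℕ → ℝ) (hs : ∀ k, 0 < s k) (hs0 : Tendsto s atTop (𝓝 0))
    (hL : Tendsto (fun k => s k * L k) atTop atTop) (M : ℝ)
    (hM : ∀ᶠ k in atTop, ∀ x ∈ box 4 (L k), ∀ x' ∈ box 4 (L k),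
      w₁ (s k • siteToE x) ≠ 0 → w₂ (s k • siteToE x') ≠ 0 →
      |(s k)⁻¹ ^ 8 * (torusE G r (β k) (L k) (fun U => dens G r x U * dens G r x' U)
          - torusE G r (β k) (L k) (dens G r x) * torusE G r (β k) (L k) (dens G r x'))
        - K (s k • siteToE x' - s k • siteToE x)| ≤ M)
    (hnear : ∀ R ε : ℝ, 0 < R → 0 < ε → ∀ᶠ k in atTop, ∀ x ∈ box 4 (L k), ∀ x' ∈ box 4 (L k),
      ‖s k • siteToE x‖ ≤ R → ‖s k • siteToE x'‖ ≤ R →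
      w₁ (s k • siteToE x) ≠ 0 → w₂ (s k • siteToE x') ≠ 0 →
      |(s k)⁻¹ ^ 8 * (torusE G r (β k) (L k) (fun U => dens G r x U * dens G r x' U)
          - torusE G r (β k) (L k) (dens G r x) * torusE G r (β k) (L k) (dens G r x'))
        - K (s k • siteToE x' - s k • siteToE x)| ≤ ε)
    (hpos : ∀ᶠ k in atTop, 0 ≤ Q2 G r (β k) (L k) (s k) w₁ w₂) :
    0 ≤ ∫ x, ∫ y, w₁ x * w₂ y * K (y - x) :=
  ge_of_tendsto (tendsto_Q2_of_near_kernel G r w₁ w₂ K t₀ ht₀ h₁ h₂ hKc hKb β L s hs hs0 hL M hM hnear) hpos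

end Summit.QuantumFields.YangMills.Cruxes.UniversalDetectorLimitExtraction
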